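import Summits.CriticalPhenomena.PercolationContinuityZ3.Theorems.PercNearOneGluingNoHeavyLowerTailSunflowerGradedSafeBlocks
import HarnessLib

/-!
# `NoHeavyLowerTail` (crux stmt-CriticalPhenomena-4575), abstract sunflower cubic: SAFE CORES — the calculus, part 2c:
# DISJOINT-CLAUSE CNF cores are gradedly safe (the K-decreasing lemma on the meta-cube of clauses)

Support file (seat `prim-ineq-prove-1` gen 34; `--supports stmt-CriticalPhenomena-4575`).  No `sorry`, no named facts.  Memo:
run/shared/lean/prim/prim-ineq-prove-1/FINDING-PRINCIPALCORE-prove1-g34.md §9.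

* `clauseCore 𝒞 = {ω | every clause C ∈ 𝒞 meets ω}` — the up-set of the CNF `⋀_{C ∈ 𝒞} ⋁_{e ∈ C} x_e`; for pairwise DISJOINT clauses this is
  the general event whose blocker has pairwise disjoint minimal elements (principal filters = singleton clauses; a single clause = an OR).
* **`prod_BEx_le_of_clauseCore`** — disjoint-clause CNFs are GRADEDLY safe (stated in unfolded form; the `GSafe`/`Safe` wrappers
  `gsafe_clauseCore`, `safe_clauseCore` are in `…SunflowerReadOnce`, which imports `…SunflowerGradedSafe` as well).  PROOF (memo §9, reformulation (1)): by antitonicity one may replace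
  `G i T` by `G i (piM 𝒞 T)` where `piM 𝒞 T` is the union of the clauses ENTIRELY contained in the missing set `T` (min-type reduction);
  the law of the set of entirely-missed clauses is a PRODUCT law on `2^𝒞` with `P(C missed) = ∏_{e ∈ C} (1 − p e)` (`BEx_piM`, Fubini over
  the disjoint clauses), so the claim is literally the K-decreasing-functions lemma `KDecreasing.prod_Ex_le_of_antitone'` on the
  meta-cube `Finset ↥𝒞` with `p̃_C = 1 − ∏_{e∈C}(1 − p e)`, and `∏_C p̃_C = μ(clauseCore 𝒞)`.
CONSEQUENCE (`…SunflowerReadOnce`): the gradedly-safe building blocks of the read-once calculus are the ORs of disjoint-clause CNFs on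
disjoint blocks (not only the ORs of ANDs), so the safe class contains every read-once core on ≤ 7 variables.  (This file is independent of
`…SunflowerGradedSafe`: it only uses the block calculus of `…SunflowerGradedSafeBlocks`.)
-/

noncomputable section

namespace Summit.CriticalPhenomena.PercolationContinuityZ3.Theorems.SunflowerPartition

namespace SafeCalc

open MeasureTheory Finset
open Literature.Probability.LatticeModels Literature.Probability.Percolation
open TwoGenCore (wmiss cyl)

variable {ι : Type*} [DecidableEq ι] (p : ι → unitInterval)

/-! ## Disjoint-clause CNF cores -/

/-- The CNF core: every clause of `𝒞` meets `ω`. [this work] -/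
def clauseCore (𝒞 : Finset (Finset ι)) : Set (Set ι) := {ω | ∀ C ∈ 𝒞, ∃ e ∈ C, e ∈ ω}

/-- The clauses entirely contained in the missing set `T`. [this work] -/
def fullMiss (𝒞 : Finset (Finset ι)) (T : Finset ι) : Finset (Finset ι) := 𝒞.filter (· ⊆ T)

/-- The union of the entirely-missed clauses (the min-type projection of the missing set). [this work] -/
def piM (𝒞 : Finset (Finset ι)) (T : Finset ι) : Finset ι := (fullMiss 𝒞 T).biUnion id

/-- Probability that the clause `C` is satisfied: `1 − ∏_{e ∈ C} (1 − p e)`. [this work] -/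
def pClause (C : Finset ι) : ℝ := 1 - ∏ e ∈ C, (1 - (p e : ℝ))

/-- The product weights of the meta-cube of clauses: `Wt 𝒞 J = ∏_{C ∈ 𝒞} (C ∈ J ? 1 − p̃_C : p̃_C)`. [this work] -/
def Wt (𝒞 : Finset (Finset ι)) (J : Finset (Finset ι)) : ℝ := ∏ C ∈ 𝒞, (if C ∈ J then 1 - pClause p C else pClause p C)

omit [DecidableEq ι] in
/-- The CNF core is an up-set. [this work] -/
theorem isUpperSet_clauseCore (𝒞 : Finset (Finset ι)) : IsUpperSet (clauseCore 𝒞) :=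
  fun _ _ hle hω C hC => by obtain ⟨e, he, heω⟩ := hω C hC; exact ⟨e, he, hle heω⟩

/-- The CNF core is determined by the union of its clauses. [this work] -/
theorem determinedBy_clauseCore (𝒞 : Finset (Finset ι)) : DeterminedBy (clauseCore 𝒞) (↑(𝒞.biUnion id) : Set ι) := by
  rw [determinedBy_iff]
  intro ω ω' h
  have key : ∀ e, e ∈ 𝒞.biUnion id → (e ∈ ω ↔ e ∈ ω') := fun e he =>
    ⟨fun h1 => ((Set.ext_iff.1 h e).1 ⟨h1, Finset.mem_coe.2 he⟩).1, fun h1 => ((Set.ext_iff.1 h e).2 ⟨h1, Finset.mem_coe.2 he⟩).1⟩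
  have mem : ∀ C ∈ 𝒞, ∀ e ∈ C, e ∈ 𝒞.biUnion id := fun C hC e he => Finset.mem_biUnion.2 ⟨C, hC, he⟩
  exact forall₂_congr fun C hC => exists_congr fun e => and_congr_right fun he => key e (mem C hC e he)

omit [DecidableEq ι] in
/-- `pClause` lies in `[0,1]`. [this work] -/
theorem pClause_mem (C : Finset ι) : 0 ≤ pClause p C ∧ pClause p C ≤ 1 := by
  have h0 : 0 ≤ ∏ e ∈ C, (1 - (p e : ℝ)) := Finset.prod_nonneg fun e _ => sub_nonneg.2 (p e).2.2
  have h1 : ∏ e ∈ C, (1 - (p e : ℝ)) ≤ 1 :=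
    Finset.prod_le_one (fun e _ => sub_nonneg.2 (p e).2.2) fun e _ => sub_le_self _ (p e).2.1
  unfold pClause
  constructor <;> linarith

/-- Weight of the cylinder "the whole block is missing". [this work] -/
theorem wmiss_self (C : Finset ι) : wmiss p C C = 1 - pClause p C := by
  unfold TwoGenCore.wmiss pClause
  rw [Finset.sdiff_self, Finset.prod_empty, mul_one, sub_sub_cancel]

/-- `piM` of the missing set along an inserted (disjoint) clause. [this work] -/
theorem piM_insert {C₀ : Finset ι} {𝒞 : Finset (Finset ι)} (hdis : ∀ C ∈ 𝒞, Disjoint C₀ C)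
    {T₀ T : Finset ι} (hT₀ : T₀ ⊆ C₀) (hT : T ⊆ 𝒞.biUnion id) :
    piM (insert C₀ 𝒞) (T₀ ∪ T) = (if T₀ = C₀ then C₀ else ∅) ∪ piM 𝒞 T := by
  have hdis' : Disjoint C₀ (𝒞.biUnion id) := Finset.disjoint_biUnion_right _ _ _ |>.2 fun C hC => hdis C hC
  have hC₀ : C₀ ⊆ T₀ ∪ T ↔ T₀ = C₀ := by
    constructor
    · intro h
      refine Finset.Subset.antisymm hT₀ fun e he => ?_
      rcases Finset.mem_union.1 (h he) with h' | h'
      · exact h'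
      · exact absurd (hT h') (Finset.disjoint_left.1 hdis' he)
    · intro h; rw [h]; exact Finset.subset_union_left
  have hrest : 𝒞.filter (· ⊆ T₀ ∪ T) = 𝒞.filter (· ⊆ T) := by
    refine Finset.filter_congr fun C hC => ⟨fun h e he => ?_, fun h => h.trans Finset.subset_union_right⟩
    rcases Finset.mem_union.1 (h he) with h' | h'
    · exact absurd (hT₀ h') (Finset.disjoint_right.1 (hdis C hC) he)
    · exact h'
  unfold piM fullMiss
  rw [Finset.filter_insert, hrest]
  by_cases h0 : T₀ = C₀
  · rw [if_pos (hC₀.2 h0), if_pos h0, Finset.biUnion_insert, id]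
  · rw [if_neg (fun h => h0 (hC₀.1 h)), if_neg h0, Finset.empty_union]

/-- **The reindexing identity** (Fubini over disjoint clauses): a block expectation of a function of the entirely-missed clauses is an
expectation on the meta-cube `2^𝒞` with the product weights `Wt`. [this work] -/
theorem BEx_piM (𝒞 : Finset (Finset ι)) (h𝒞 : ∀ C ∈ 𝒞, ∀ D ∈ 𝒞, C ≠ D → Disjoint C D) (H : Finset ι → ℝ) :
    BEx p (𝒞.biUnion id) (fun T => H (piM 𝒞 T)) = ∑ J ∈ 𝒞.powerset, Wt p 𝒞 J * H (J.biUnion id) := by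
  induction 𝒞 using Finset.induction_on generalizing H with
  | empty =>
    unfold BEx Wt
    rw [Finset.biUnion_empty, Finset.powerset_empty, Finset.sum_singleton, Finset.powerset_empty, Finset.sum_singleton,
      Finset.prod_empty, Finset.biUnion_empty]
    unfold TwoGenCore.wmiss piM fullMiss
    simp
  | @insert C₀ 𝒞 hC₀ ih =>
    have hdis : ∀ C ∈ 𝒞, Disjoint C₀ C := fun C hC =>
      h𝒞 C₀ (Finset.mem_insert_self _ _) C (Finset.mem_insert_of_mem hC) (fun h => hC₀ (h ▸ hC))
    have h𝒞' : ∀ C ∈ 𝒞, ∀ D ∈ 𝒞, C ≠ D → Disjoint C D := fun C hC D hD hne =>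
      h𝒞 C (Finset.mem_insert_of_mem hC) D (Finset.mem_insert_of_mem hD) hne
    have hdis' : Disjoint C₀ (𝒞.biUnion id) := (Finset.disjoint_biUnion_right _ _ _).2 fun C hC => hdis C hC
    rw [Finset.biUnion_insert, id, BEx_union p hdis']
    -- inner expectation by the induction hypothesis
    have hinner : ∀ T₀, T₀ ⊆ C₀ → BEx p (𝒞.biUnion id) (fun T => H (piM (insert C₀ 𝒞) (T₀ ∪ T))) =
        ∑ J ∈ 𝒞.powerset, Wt p 𝒞 J * H ((if T₀ = C₀ then C₀ else ∅) ∪ J.biUnion id) := by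
      intro T₀ hT₀
      rw [← ih h𝒞' (fun S => H ((if T₀ = C₀ then C₀ else ∅) ∪ S))]
      refine Finset.sum_congr rfl fun T hT => ?_
      dsimp only
      rw [piM_insert hdis hT₀ (Finset.mem_powerset.1 hT)]
    have hstep : BEx p C₀ (fun T₀ => BEx p (𝒞.biUnion id) (fun T => H (piM (insert C₀ 𝒞) (T₀ ∪ T)))) =
        BEx p C₀ (fun T₀ => ∑ J ∈ 𝒞.powerset, Wt p 𝒞 J * H ((if T₀ = C₀ then C₀ else ∅) ∪ J.biUnion id)) :=
      Finset.sum_congr rfl fun T₀ hT₀ => by dsimp only; rw [hinner T₀ (Finset.mem_powerset.1 hT₀)]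
    rw [hstep]
    -- outer expectation: only `T₀ = C₀` versus `T₀ ≠ C₀` matters
    set Φ₁ := ∑ J ∈ 𝒞.powerset, Wt p 𝒞 J * H (C₀ ∪ J.biUnion id) with hΦ₁
    set Φ₀ := ∑ J ∈ 𝒞.powerset, Wt p 𝒞 J * H (J.biUnion id) with hΦ₀
    have hfun : ∀ T₀ ∈ C₀.powerset, wmiss p C₀ T₀ * (∑ J ∈ 𝒞.powerset, Wt p 𝒞 J * H ((if T₀ = C₀ then C₀ else ∅) ∪ J.biUnion id)) =
        wmiss p C₀ T₀ * Φ₀ + (if T₀ = C₀ then wmiss p C₀ T₀ * (Φ₁ - Φ₀) else 0) := by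
      intro T₀ _
      split_ifs with h
      · rw [h]; ring
      · simp only [Finset.empty_union]; ring
    have hL : BEx p C₀ (fun T₀ => ∑ J ∈ 𝒞.powerset, Wt p 𝒞 J * H ((if T₀ = C₀ then C₀ else ∅) ∪ J.biUnion id)) =
        Φ₀ + (1 - pClause p C₀) * (Φ₁ - Φ₀) := by
      unfold BEx
      rw [Finset.sum_congr rfl hfun, Finset.sum_add_distrib, ← Finset.sum_mul, sum_wmiss, one_mul,
        Finset.sum_ite_eq' (C₀.powerset) C₀, if_pos (Finset.mem_powerset.2 subset_rfl), wmiss_self]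
    rw [hL]
    -- the right-hand side over `insert C₀ 𝒞`
    have hW0 : ∀ J ∈ 𝒞.powerset, Wt p (insert C₀ 𝒞) J = pClause p C₀ * Wt p 𝒞 J := by
      intro J hJ
      have hJ : C₀ ∉ J := fun h => hC₀ (Finset.mem_powerset.1 hJ h)
      unfold Wt
      rw [Finset.prod_insert hC₀, if_neg hJ]
    have hW1 : ∀ J ∈ 𝒞.powerset, Wt p (insert C₀ 𝒞) (insert C₀ J) = (1 - pClause p C₀) * Wt p 𝒞 J := by
      intro J _
      unfold Wt
      rw [Finset.prod_insert hC₀, if_pos (Finset.mem_insert_self _ _)]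
      congr 1
      refine Finset.prod_congr rfl fun C hC => ?_
      have hne : C ≠ C₀ := fun h => hC₀ (h ▸ hC)
      simp only [Finset.mem_insert, hne, false_or]
    have e0 : ∑ J ∈ 𝒞.powerset, Wt p (insert C₀ 𝒞) J * H (J.biUnion id) = pClause p C₀ * Φ₀ := by
      rw [hΦ₀, Finset.mul_sum]
      exact Finset.sum_congr rfl fun J hJ => by rw [hW0 J hJ, mul_assoc]
    have e1 : ∑ J ∈ 𝒞.powerset, Wt p (insert C₀ 𝒞) (insert C₀ J) * H ((insert C₀ J).biUnion id) = (1 - pClause p C₀) * Φ₁ := by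
      rw [hΦ₁, Finset.mul_sum]
      exact Finset.sum_congr rfl fun J hJ => by rw [hW1 J hJ, Finset.biUnion_insert, id, mul_assoc]
    rw [Finset.sum_powerset_insert hC₀, e0, e1]
    ring

/-- Good block points of the CNF core: no clause is entirely missed. [this work] -/
theorem sdiff_mem_clauseCore_iff {𝒞 : Finset (Finset ι)} {T : Finset ι} :
    ((𝒞.biUnion id \ T : Finset ι) : Set ι) ∈ clauseCore 𝒞 ↔ ∀ C ∈ 𝒞, ¬ C ⊆ T := by
  constructor
  · rintro h C hC hCT
    obtain ⟨e, he, he'⟩ := h C hC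
    exact (Finset.mem_sdiff.1 (Finset.mem_coe.1 he')).2 (hCT he)
  · intro h C hC
    obtain ⟨e, he, heT⟩ := Finset.not_subset.1 (h C hC)
    exact ⟨e, he, Finset.mem_coe.2 (Finset.mem_sdiff.2 ⟨Finset.mem_biUnion.2 ⟨C, hC, he⟩, heT⟩)⟩

/-- With nonempty clauses, `piM` is empty iff no clause is entirely missed. [this work] -/
theorem piM_eq_empty_iff {𝒞 : Finset (Finset ι)} (hne : ∀ C ∈ 𝒞, C.Nonempty) (T : Finset ι) :
    piM 𝒞 T = ∅ ↔ ∀ C ∈ 𝒞, ¬ C ⊆ T := by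
  rw [← Finset.not_nonempty_iff_eq_empty, piM, Finset.biUnion_nonempty]
  constructor
  · intro h C hC hCT
    exact h ⟨C, Finset.mem_filter.2 ⟨hC, hCT⟩, hne C hC⟩
  · rintro h ⟨C, hC, -⟩
    exact h C (Finset.mem_filter.1 hC).1 (Finset.mem_filter.1 hC).2

/-- With nonempty clauses, a union of clauses is empty iff there are none. [this work] -/
theorem biUnion_id_eq_empty_iff {𝒞 J : Finset (Finset ι)} (hne : ∀ C ∈ 𝒞, C.Nonempty) (hJ : J ⊆ 𝒞) :
    J.biUnion id = ∅ ↔ J = ∅ := by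
  rw [← Finset.not_nonempty_iff_eq_empty, Finset.biUnion_nonempty, ← Finset.not_nonempty_iff_eq_empty]
  exact not_congr ⟨fun ⟨C, hC, _⟩ => ⟨C, hC⟩, fun ⟨C, hC⟩ => ⟨C, hC, hne C (hJ hC)⟩⟩

/-- **DISJOINT-CLAUSE CNF CORES ARE GRADEDLY SAFE** (memo §9), in unfolded form: the K-decreasing lemma on the meta-cube of clauses
(the hypothesis "`G i T = 1` at good `T`" of `GSafe` is not even needed). [this work] -/
theorem prod_BEx_le_of_clauseCore [Fintype ι] (𝒞 : Finset (Finset ι)) (h𝒞 : ∀ C ∈ 𝒞, ∀ D ∈ 𝒞, C ≠ D → Disjoint C D)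
    (hne : ∀ C ∈ 𝒞, C.Nonempty) (n : ℕ) {c : ℝ} (hc : 0 < c) (hc1 : c ≤ 1) (G : Fin n → Finset ι → ℝ)
    (hanti : ∀ i, ∀ T T' : Finset ι, T ⊆ T' → T' ⊆ 𝒞.biUnion id → G i T' ≤ G i T)
    (hle1 : ∀ i, ∀ T : Finset ι, T ⊆ 𝒞.biUnion id → G i T ≤ 1) (hge : ∀ i, ∀ T : Finset ι, T ⊆ 𝒞.biUnion id → c ≤ G i T)
    (hbad : ∀ T : Finset ι, T ⊆ 𝒞.biUnion id → ((𝒞.biUnion id \ T : Finset ι) : Set ι) ∉ clauseCore 𝒞 → ∏ i, G i T ≤ c ^ (n - 1)) :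
    ∏ i, BEx p (𝒞.biUnion id) (G i) ≤
      ((prodBernoulli p).real (clauseCore 𝒞) + (1 - (prodBernoulli p).real (clauseCore 𝒞)) * c) ^ (n - 1) := by
  classical
  set a := 𝒞.biUnion id
  have hπT : ∀ T : Finset ι, piM 𝒞 T ⊆ T := fun T =>
    Finset.biUnion_subset.2 fun C hC => by simpa [fullMiss] using (Finset.mem_filter.1 hC).2
  have hJa : ∀ J : Finset (Finset ι), J ⊆ 𝒞 → J.biUnion id ⊆ a := fun J hJ => Finset.biUnion_subset_biUnion_of_subset_left id hJ
  -- step 1: min-type reduction `G i T ≤ G i (piM T)`; step 2: reindex to the meta-cube; step 3: the K-decreasing lemma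
  have h1 : ∏ i, BEx p a (G i) ≤ ∏ i, BEx p a (fun T => G i (piM 𝒞 T)) :=
    Finset.prod_le_prod (fun i _ => le_of_eq_of_le (BEx_const p a 0).symm (BEx_mono p a fun T hT => hc.le.trans (hge i T hT)))
      fun i _ => BEx_mono p a fun T hT => hanti i _ _ (hπT T) hT
  refine h1.trans ?_
  rw [Finset.prod_congr rfl fun i _ => BEx_piM p 𝒞 h𝒞 (G i)]
  -- the probability of the core
  have hcore : (prodBernoulli p).real (clauseCore 𝒞) = ∏ C ∈ 𝒞, pClause p C := by
    rw [real_eq_BEx p (𝒞.biUnion id) (clauseCore 𝒞)]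
    unfold BEx
    have hsum : ∀ T ∈ (𝒞.biUnion id).powerset,
        wmiss p (𝒞.biUnion id) T * (prodBernoulli p).real (sect (𝒞.biUnion id) T (clauseCore 𝒞)) =
        wmiss p (𝒞.biUnion id) T * (fun S : Finset ι => if S = ∅ then (1 : ℝ) else 0) (piM 𝒞 T) := by
      intro T hT
      congr 1
      dsimp only
      by_cases h : (((𝒞.biUnion id) \ T : Finset ι) : Set ι) ∈ clauseCore 𝒞
      · rw [sect_eq_univ_of_mem (determinedBy_clauseCore 𝒞) h, probReal_univ,
          if_pos ((piM_eq_empty_iff hne T).2 (sdiff_mem_clauseCore_iff.1 h))]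
      · rw [sect_eq_empty_of_not_mem (determinedBy_clauseCore 𝒞) h, measureReal_empty,
          if_neg (fun h0 => h (sdiff_mem_clauseCore_iff.2 ((piM_eq_empty_iff hne T).1 h0)))]
    rw [Finset.sum_congr rfl hsum]
    have hre := BEx_piM p 𝒞 h𝒞 (fun S : Finset ι => if S = ∅ then (1 : ℝ) else 0)
    unfold BEx at hre
    rw [hre]
    have hJ : ∀ J ∈ 𝒞.powerset, Wt p 𝒞 J * (if J.biUnion id = ∅ then (1 : ℝ) else 0) = if J = ∅ then Wt p 𝒞 ∅ else 0 := by
      intro J hJ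
      have hJ' := Finset.mem_powerset.1 hJ
      by_cases h0 : J = ∅
      · rw [h0, if_pos (Finset.biUnion_empty), if_pos rfl, mul_one]
      · rw [if_neg h0, if_neg (fun h => h0 ((biUnion_id_eq_empty_iff hne hJ').1 h)), mul_zero]
    rw [Finset.sum_congr rfl hJ, Finset.sum_ite_eq' 𝒞.powerset ∅, if_pos (Finset.empty_mem_powerset _)]
    unfold Wt
    exact Finset.prod_congr rfl fun C _ => by rw [if_neg (Finset.notMem_empty C)]
  rw [hcore]
  -- step 3: transport to the subtype meta-cube `Finset ↥𝒞` and apply the K-decreasing-functions lemma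
  let emb := Function.Embedding.subtype (· ∈ 𝒞)
  let q : ↥𝒞 → ℝ := fun C => pClause p (C : Finset ι)
  have hq : ∀ x : ↥𝒞, 0 ≤ q x ∧ q x ≤ 1 := fun x => pClause_mem p _
  let G' : Fin n → Finset ↥𝒞 → ℝ := fun i S => G i ((S.map emb).biUnion id)
  have hmapsub : ∀ S : Finset ↥𝒞, S.map emb ⊆ 𝒞 := by
    intro S C hC
    rw [Finset.mem_map] at hC
    obtain ⟨x, _, rfl⟩ := hC
    exact x.2
  have key := KDecreasing.prod_Ex_le_of_antitone' (g := ↥𝒞) (Finset.univ : Finset (Fin n)) hq hc hc1 G'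
    (fun i _ S S' hSS' => hanti i _ _ (Finset.biUnion_subset_biUnion_of_subset_left id (Finset.map_subset_map.2 hSS'))
      (hJa _ (hmapsub S')))
    (fun i _ S => hge i _ (hJa _ (hmapsub S))) (fun i _ S => hle1 i _ (hJa _ (hmapsub S))) ?_
  · have hP1 : ∏ x : ↥𝒞, q x = ∏ C ∈ 𝒞, pClause p C := Finset.prod_coe_sort 𝒞 (fun C => pClause p C)
    rw [hP1, Finset.card_univ, Fintype.card_fin] at key
    have hEx : ∀ i, ∑ J ∈ 𝒞.powerset, Wt p 𝒞 J * G i (J.biUnion id) = KDecreasing.Ex (g := ↥𝒞) q (G' i) := by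
      intro i
      unfold KDecreasing.Ex
      symm
      refine Finset.sum_bij (fun S _ => S.map emb) (fun S _ => Finset.mem_powerset.2 (hmapsub S))
        (fun S _ S' _ h => Finset.map_injective _ h) (fun J hJ => ?_) (fun S _ => ?_)
      · refine ⟨J.subtype (· ∈ 𝒞), Finset.mem_univ _, ?_⟩
        rw [Finset.mem_powerset] at hJ
        exact Finset.subtype_map_of_mem fun x hx => hJ hx
      · congr 1
        unfold KDecreasing.wt Wt
        set J := S.map emb with hJ
        rw [← Finset.prod_coe_sort 𝒞 (fun C => if C ∈ J then 1 - pClause p C else pClause p C)]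
        refine Finset.prod_congr rfl fun x _ => ?_
        have hx : ((x : Finset ι) ∈ J) ↔ x ∈ S := by rw [hJ]; exact Finset.mem_map' _
        by_cases hxS : x ∈ S
        · rw [if_pos hxS, if_pos (hx.2 hxS)]
        · rw [if_neg hxS, if_neg (fun h => hxS (hx.1 h))]
    calc ∏ i, ∑ J ∈ 𝒞.powerset, Wt p 𝒞 J * G i (J.biUnion id) = ∏ i, KDecreasing.Ex (g := ↥𝒞) q (G' i) :=
          Finset.prod_congr rfl fun i _ => hEx i
      _ ≤ ((∏ C ∈ 𝒞, pClause p C) + (1 - ∏ C ∈ 𝒞, pClause p C) * c) ^ (n - 1) := key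
  · intro S hS
    rw [Finset.card_univ, Fintype.card_fin]
    refine hbad _ (hJa _ (hmapsub S)) fun hgood => ?_
    obtain ⟨x, hx⟩ := hS
    have hxJ : (x : Finset ι) ∈ S.map emb := Finset.mem_map_of_mem emb hx
    rw [sdiff_mem_clauseCore_iff] at hgood
    exact hgood x x.2 (Finset.subset_biUnion_of_mem id hxJ)

end SafeCalc

end Summit.CriticalPhenomena.PercolationContinuityZ3.Theorems.SunflowerPartition
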